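import Summits.PneNP.PneNP.Theorems.SymmetryBudgetHamCompilesFDagSem

/-!
# The F-side gate DAG of the line `kotzig-cutspan` is acyclic
# (stub `stub_symmetricF`, obligation `stub_symmetricF_aut`, part 1/3;
# crux `SymmetryBudget.HamCompiles`, stmt-PneNP-10637)

Every wire of every gate of the F-side DAG (`SymmetryBudgetHamCompilesFDag.lean`) comes from a gate
of strictly smaller measure `fμ` (`SymmetryBudgetHamCompilesFDagSem.lean`, §5: DP stage, zone,
tower / inner position, block index, internal block stage, compared lexicographically), hence the
child relation `fun l' l => ∃ a, fargs l a = Sum.inr l'` is well founded (`fargs_acyclic`, the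
first clause of `SymF.AutProps`). The proof is one bound per composite wire (`uW`, `cTab`, `oTab`,
`accW`, `leftW`, `tabW`, `rowW`, `zW`) followed by a case analysis over the gate labels.
-/

-- `Summit.PneNP.PneNP.…` duplicates `PneNP` BY DESIGN (single-problem summit, D-0017).
set_option linter.dupNamespace false

noncomputable section

namespace Summit.PneNP.PneNP.Theorems.HamCompilesKC

open Literature.Computability.Complexity
open Finset

namespace SymF

variable {m : ℕ}

/-- Values of the measure `fμ` (a notation: this file introduces no definitions). -/
local notation "M5[" a ", " b ", " c ", " d ", " e "]" =>
  (toLex (a, toLex (b, toLex (c, toLex (d, e)))) : ℕ ×ₗ ℕ ×ₗ ℕ ×ₗ ℕ ×ₗ ℕ)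

/-! ### Lexicographic comparisons reduced to linear arithmetic -/

/-- Strict comparison of measure values. -/
theorem M5_lt {a b c d e a' b' c' d' e' : ℕ}
    (h : a < a' ∨
      a = a' ∧ (b < b' ∨ b = b' ∧ (c < c' ∨ c = c' ∧ (d < d' ∨ d = d' ∧ e < e')))) :
    M5[a, b, c, d, e] < M5[a', b', c', d', e'] := by
  rcases h with h | ⟨rfl, h⟩
  · exact Prod.Lex.toLex_lt_toLex.2 (Or.inl h)
  refine Prod.Lex.toLex_lt_toLex.2 (Or.inr ⟨rfl, ?_⟩)
  rcases h with h | ⟨rfl, h⟩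
  · exact Prod.Lex.toLex_lt_toLex.2 (Or.inl h)
  refine Prod.Lex.toLex_lt_toLex.2 (Or.inr ⟨rfl, ?_⟩)
  rcases h with h | ⟨rfl, h⟩
  · exact Prod.Lex.toLex_lt_toLex.2 (Or.inl h)
  refine Prod.Lex.toLex_lt_toLex.2 (Or.inr ⟨rfl, ?_⟩)
  rcases h with h | ⟨rfl, h⟩
  · exact Prod.Lex.toLex_lt_toLex.2 (Or.inl h)
  exact Prod.Lex.toLex_lt_toLex.2 (Or.inr ⟨rfl, h⟩)

/-- Weak comparison of measure values. -/
theorem M5_le {a b c d e a' b' c' d' e' : ℕ}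
    (h : a < a' ∨
      a = a' ∧ (b < b' ∨ b = b' ∧ (c < c' ∨ c = c' ∧ (d < d' ∨ d = d' ∧ e ≤ e')))) :
    M5[a, b, c, d, e] ≤ M5[a', b', c', d', e'] := by
  rcases h with h | ⟨rfl, h⟩
  · exact Prod.Lex.toLex_le_toLex.2 (Or.inl h)
  refine Prod.Lex.toLex_le_toLex.2 (Or.inr ⟨rfl, ?_⟩)
  rcases h with h | ⟨rfl, h⟩
  · exact Prod.Lex.toLex_le_toLex.2 (Or.inl h)
  refine Prod.Lex.toLex_le_toLex.2 (Or.inr ⟨rfl, ?_⟩)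
  rcases h with h | ⟨rfl, h⟩
  · exact Prod.Lex.toLex_le_toLex.2 (Or.inl h)
  refine Prod.Lex.toLex_le_toLex.2 (Or.inr ⟨rfl, ?_⟩)
  rcases h with h | ⟨rfl, h⟩
  · exact Prod.Lex.toLex_le_toLex.2 (Or.inl h)
  exact Prod.Lex.toLex_le_toLex.2 (Or.inr ⟨rfl, h⟩)

/-! ### Elementary wires -/

/-- A gate wire of the F-side proper names its gate. -/
theorem eq_of_fW_eq {f : FG m} {l' : FΛ m} (h : fW f = Sum.inr l') : l' = Sum.inr f :=
  (Sum.inr_injective h).symm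

/-- A gadget wire names its gate. -/
theorem eq_of_gW_eq {l : SymA.RΛ m} {l' : FΛ m} (h : gW l = Sum.inr l') : l' = Sum.inl l :=
  (Sum.inr_injective h).symm

/-- The constant-false gate has the least measure. -/
theorem fμ_zero_lt {a b c d e : ℕ} (ha : 0 < a) :
    fμ (Sum.inr FG.zero : FΛ m) < M5[a, b, c, d, e] :=
  M5_lt (Or.inl ha)

/-- DP stages are positive. -/
theorem tstage_pos (τ : TCtx m) : 0 < tstage τ := by
  cases τ <;> simp [tstage]

/-- DP stage of an open state. -/
theorem tstage_ot (P : PSet m) (t : Fin m) (i : Fin (gOf m)) (e : Cd m) :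
    tstage (TCtx.ot P t i e) = 2 * P.1.card + 2 := rfl

/-- DP stage of a closed state. -/
theorem tstage_ct (P : PSet m) (e : Cd m) : tstage (TCtx.ct P e) = 2 * P.1.card + 3 := rfl

/-! ### Bounds for the composite wires -/

/-- Tower table wires. -/
theorem fμ_uW_le (τ : TCtx m) (B : PSet m) (c c' : K m) {l' : FΛ m}
    (h : uW τ B c c' = Sum.inr l') : fμ l' ≤ M5[tstage τ, 1, 2 * B.1.card + 1, 0, 0] := by
  cases τ with
  | ot P t i e =>
    simp only [uW] at h
    split_ifs at h with hB
    · obtain rfl := eq_of_fW_eq h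
      rw [hB, Finset.card_empty]
      exact M5_le (by omega)
    · obtain rfl := eq_of_fW_eq h
      exact le_rfl
  | ct P e =>
    simp only [uW] at h
    split_ifs at h with hB
    · obtain rfl := eq_of_fW_eq h
      exact (fμ_zero_lt (tstage_pos _)).le
    · obtain rfl := eq_of_fW_eq h
      exact le_rfl

/-- Closed-state table wires. -/
theorem fμ_cTab_lt (P : PSet m) (e : Cd m) (c c' : K m) {l' : FΛ m}
    (h : cTab P e c c' = Sum.inr l') : fμ l' < M5[2 * P.1.card + 4, 0, 0, 0, 0] := by
  unfold cTab at h
  split_ifs at h with hP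
  · obtain rfl := eq_of_fW_eq h
    exact M5_lt (Or.inl (by omega))
  · refine (fμ_uW_le _ _ _ _ h).trans_lt (M5_lt (Or.inl ?_))
    simp only [tstage]
    omega

/-- Open-state table wires. -/
theorem fμ_oTab_lt (P : PSet m) (t : Fin m) (i : Fin (gOf m)) (e : Cd m) (c c' : K m) {l' : FΛ m}
    (h : oTab P t i e c c' = Sum.inr l') : fμ l' < M5[2 * P.1.card + 3, 0, 0, 0, 0] := by
  unfold oTab at h
  split_ifs at h with ht
  · refine (fμ_uW_le _ _ _ _ h).trans_lt (M5_lt (Or.inl ?_))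
    simp only [tstage]
    omega
  · obtain rfl := eq_of_fW_eq h
    exact M5_lt (Or.inl (by omega))

/-- Inner accumulator wires. -/
theorem fμ_accW_lt (P : PSet m) (e : Cd m) (t : Fin m) (r : ℕ) (c c' : K m) {l' : FΛ m}
    (h : accW P e t r c c' = Sum.inr l') : fμ l' < M5[2 * P.1.card + 3, 0, r, 0, 0] := by
  unfold accW chOut at h
  split_ifs at h with h0 h1
  · obtain rfl := eq_of_fW_eq h
    exact M5_lt (Or.inl (by omega))
  · obtain rfl := eq_of_fW_eq h
    show M5[2 * P.1.card + 3, 0, r - 1, N m - 1, bstage m (BK.out c c')] < _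
    exact M5_lt (by omega)
  · obtain rfl := eq_of_fW_eq h
    exact M5_lt (Or.inl (by omega))

/-- Internal block stages are positive. -/
theorem bstage_pos (κ : BK m) : 0 < bstage m κ := by
  cases κ <;> simp only [bstage] <;> omega

/-- Left table wires lie below every block gate of their chain. -/
theorem fμ_leftW_lt (χ : ChCtx m) (c c' : K m) (k : Fin (N m)) (κ : BK m) {l' : FΛ m}
    (h : leftW χ c c' = Sum.inr l') : fμ l' < fμ (Sum.inr (FG.blk χ k κ) : FΛ m) := by
  cases χ with
  | tw τ B w =>
    simp only [leftW] at h
    split_ifs at h with hw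
    · have hc : (B.erase w).1.card = B.1.card - 1 := Finset.card_erase_of_mem hw
      have hp : 0 < B.1.card := Finset.card_pos.2 ⟨w, hw⟩
      exact (fμ_uW_le _ _ _ _ h).trans_lt (M5_lt (by omega))
    · obtain rfl := eq_of_fW_eq h
      exact fμ_zero_lt (tstage_pos τ)
  | inner P e t r =>
    have := tstage_ct P e
    exact (fμ_accW_lt P e t r c c' h).trans_le (M5_le (by omega))

/-- Block gates of one chain are ordered by block index, then internal stage. -/
theorem fμ_blk_lt_blk (χ : ChCtx m) {k k' : Fin (N m)} {κ κ' : BK m}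
    (h : (k' : ℕ) < k ∨ (k' : ℕ) = k ∧ bstage m κ' < bstage m κ) :
    fμ (Sum.inr (FG.blk χ k' κ') : FΛ m) < fμ (Sum.inr (FG.blk χ k κ) : FΛ m) := by
  cases χ <;> exact M5_lt (by omega)

/-- Table wires lie below every block gate of their block. -/
theorem fμ_tabW_lt (χ : ChCtx m) (k : Fin (N m)) (c c' : K m) (κ : BK m) {l' : FΛ m}
    (h : tabW χ k c c' = Sum.inr l') : fμ l' < fμ (Sum.inr (FG.blk χ k κ) : FΛ m) := by
  unfold tabW at h
  split_ifs at h with hk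
  · exact fμ_leftW_lt χ c c' k κ h
  · obtain rfl := eq_of_fW_eq h
    exact fμ_blk_lt_blk χ (Or.inl (by show (k : ℕ) - 1 < k; omega))

/-- Row-source wires lie below every block gate of their block. -/
theorem fμ_rowW_lt (χ : ChCtx m) (k : Fin (N m)) (c' : K m) (κ : BK m) {l' : FΛ m}
    (h : rowW χ k c' = Sum.inr l') : fμ l' < fμ (Sum.inr (FG.blk χ k κ) : FΛ m) := by
  have hκ := bstage_pos κ
  cases χ with
  | tw τ B w =>
    cases τ with
    | ot P t i e =>
      obtain rfl := eq_of_fW_eq h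
      exact M5_lt (by omega)
    | ct P e =>
      have := tstage_ct P e
      exact (fμ_accW_lt P e w _ (kc k) c' h).trans_le (M5_le (by omega))
  | inner P e t r =>
    simp only [rowW] at h
    split_ifs at h
    · obtain rfl := eq_of_fW_eq h
      exact M5_lt (by omega)
    · obtain rfl := eq_of_fW_eq h
      exact fμ_zero_lt (tstage_pos _)

/-- Remainder wires `z^{(s)}` (the final remainder at `s = N`) lie below the block gates of internal
stage `> 4s`. -/
theorem fμ_zW_lt (χ : ChCtx m) (k : Fin (N m)) (s : ℕ) (c' : K m) (κ : BK m)
    (hs : 4 * s < bstage m κ) {l' : FΛ m} (h : zW χ k s c' = Sum.inr l') :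
    fμ l' < fμ (Sum.inr (FG.blk χ k κ) : FΛ m) := by
  unfold zW at h
  split_ifs at h with h0 h1
  · exact fμ_rowW_lt χ k c' κ h
  · obtain rfl := eq_of_fW_eq h
    refine fμ_blk_lt_blk χ (Or.inr ⟨rfl, ?_⟩)
    show 4 * (s - 1) + 4 < bstage m κ
    omega
  · obtain rfl := eq_of_fW_eq h
    cases χ <;> exact fμ_zero_lt (tstage_pos _)

/-- A wire to an earlier gate of the same block. -/
theorem fμ_blk_lt {χ : ChCtx m} {k : Fin (N m)} {κ κ' : BK m} (hκ : bstage m κ' < bstage m κ)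
    {l' : FΛ m} (h : fW (FG.blk χ k κ') = Sum.inr l') :
    fμ l' < fμ (Sum.inr (FG.blk χ k κ) : FΛ m) := by
  obtain rfl := eq_of_fW_eq h
  exact fμ_blk_lt_blk χ (Or.inr ⟨rfl, hκ⟩)

/-! ### The gates -/

/-- **Block gates**: every wire of a block gate comes from a gate of smaller measure. -/
theorem fμ_lt_of_bargs (χ : ChCtx m) (k : Fin (N m)) (κ : BK m) (a : Fin (bfn m κ).1)
    {l' : FΛ m} (h : bargs χ k κ a = Sum.inr l') :
    fμ l' < fμ (Sum.inr (FG.blk χ k κ) : FΛ m) := by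
  cases κ with
  | ya s c' =>
    revert h; refine Fin.cases ?_ (Fin.cases ?_ (fun j => j.elim0)) a
    · exact fμ_rowW_lt χ k (kc s) _
    · exact fμ_tabW_lt χ k (kc s) c' _
  | xo s c' =>
    revert h; refine Fin.cases ?_ (Fin.cases ?_ (fun j => j.elim0)) a
    · exact fμ_zW_lt χ k s c' _ (by simp only [bstage]; omega)
    · exact fμ_blk_lt (by simp only [bstage]; omega)
  | xa s c' =>
    revert h; refine Fin.cases ?_ (Fin.cases ?_ (fun j => j.elim0)) a
    · exact fμ_zW_lt χ k s c' _ (by simp only [bstage]; omega)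
    · exact fμ_blk_lt (by simp only [bstage]; omega)
  | xn s c' =>
    revert h; refine Fin.cases ?_ (fun j => j.elim0) a
    exact fμ_blk_lt (by simp only [bstage]; omega)
  | xr s c' =>
    revert h; refine Fin.cases ?_ (Fin.cases ?_ (fun j => j.elim0)) a <;>
      exact fμ_blk_lt (by simp only [bstage]; omega)
  | nz c =>
    revert h; refine Fin.cases ?_ (fun j => j.elim0) a
    exact fμ_zW_lt χ k (N m) c _ (by simp only [bstage]; omega)
  | ld c =>
    revert h; refine Fin.cases ?_ (fun s => ?_) a
    · exact fμ_zW_lt χ k (N m) c _ (by simp only [bstage]; omega)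
    · intro h
      change (if skey (kc s) < skey c then fW (FG.blk χ k (.nz (kc s))) else oneW) = Sum.inr l'
        at h
      split_ifs at h
      · exact fμ_blk_lt (by simp only [bstage]; omega) h
      · obtain rfl := eq_of_fW_eq h
        cases χ <;> exact M5_lt (Or.inl (tstage_pos _))
  | al c ℓ =>
    revert h; refine Fin.cases ?_ (Fin.cases ?_ (fun j => j.elim0)) a
    · exact fμ_blk_lt (by simp only [bstage]; omega)
    · exact fμ_tabW_lt χ k c ℓ _
  | q c => exact fμ_blk_lt (by simp only [bstage]; omega) h
  | nl c =>
    revert h; refine Fin.cases ?_ (fun j => j.elim0) a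
    exact fμ_blk_lt (by simp only [bstage]; omega)
  | t1 c c' =>
    revert h; refine Fin.cases ?_ (Fin.cases ?_ (fun j => j.elim0)) a
    · exact fμ_blk_lt (by simp only [bstage]; omega)
    · exact fμ_zW_lt χ k (N m) c' _ (by simp only [bstage]; omega)
  | wq c c' =>
    revert h; refine Fin.cases ?_ (Fin.cases ?_ (fun j => j.elim0)) a
    · exact fμ_zW_lt χ k (N m) c' _ (by simp only [bstage]; omega)
    · exact fμ_blk_lt (by simp only [bstage]; omega)
  | uo c c' =>
    revert h; refine Fin.cases ?_ (Fin.cases ?_ (fun j => j.elim0)) a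
    · exact fμ_tabW_lt χ k c c' _
    · exact fμ_blk_lt (by simp only [bstage]; omega)
  | ua c c' =>
    revert h; refine Fin.cases ?_ (Fin.cases ?_ (fun j => j.elim0)) a
    · exact fμ_tabW_lt χ k c c' _
    · exact fμ_blk_lt (by simp only [bstage]; omega)
  | un c c' =>
    revert h; refine Fin.cases ?_ (fun j => j.elim0) a
    exact fμ_blk_lt (by simp only [bstage]; omega)
  | ux c c' =>
    revert h; refine Fin.cases ?_ (Fin.cases ?_ (fun j => j.elim0)) a <;>
      exact fμ_blk_lt (by simp only [bstage]; omega)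
  | t2 c c' =>
    revert h; refine Fin.cases ?_ (Fin.cases ?_ (fun j => j.elim0)) a <;>
      exact fμ_blk_lt (by simp only [bstage]; omega)
  | out c c' =>
    revert h; refine Fin.cases ?_ (Fin.cases ?_ (fun j => j.elim0)) a <;>
      exact fμ_blk_lt (by simp only [bstage]; omega)

/-- **F-side gates**: every wire of a gate comes from a gate of smaller measure. -/
theorem fμ_lt_of_gargs (f : FG m) (a : Fin (gfn m f).1) {l' : FΛ m}
    (h : gargs f a = Sum.inr l') : fμ l' < fμ (Sum.inr f : FΛ m) := by
  cases f with
  | zero => exact a.elim0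
  | one => exact a.elim0
  | unitC e c c' => exact a.elim0
  | ob P t i e c c' =>
    revert h
    refine Fin.cases ?_ (Fin.cases ?_ (fun j => j.elim0)) a
    · intro h
      obtain rfl := eq_of_gW_eq h
      exact M5_lt (Or.inl (by rw [tstage_ot]; omega))
    · intro h
      change (if t ∈ P.1 then cTab (P.erase t) e c c' else zeroW) = Sum.inr l' at h
      split_ifs at h with ht
      · have hc : (P.erase t).1.card = P.1.card - 1 := Finset.card_erase_of_mem ht
        have hp : 0 < P.1.card := Finset.card_pos.2 ⟨t, ht⟩
        have := tstage_ot P t i e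
        exact (fμ_cTab_lt _ _ _ _ h).trans_le (M5_le (by omega))
      · obtain rfl := eq_of_fW_eq h
        exact fμ_zero_lt (tstage_pos _)
  | tw τ B c c' =>
    change (if a ∈ B.1 then chOut (.tw τ B a) c c' else zeroW) = Sum.inr l' at h
    split_ifs at h with ha
    · obtain rfl := eq_of_fW_eq h
      cases τ <;> exact M5_lt (by omega)
    · obtain rfl := eq_of_fW_eq h
      exact fμ_zero_lt (tstage_pos _)
  | rowO P t i e w k c' =>
    revert h
    refine Fin.cases ?_ (Fin.cases ?_ (fun j => j.elim0)) a
    · intro h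
      obtain rfl := eq_of_gW_eq h
      exact M5_lt (Or.inl (by rw [tstage_ot]; omega))
    · intro h
      change (if t ∈ P.1 then oTab (P.erase t) w i e (kc k) c' else zeroW) = Sum.inr l' at h
      split_ifs at h with ht
      · have hc : (P.erase t).1.card = P.1.card - 1 := Finset.card_erase_of_mem ht
        have hp : 0 < P.1.card := Finset.card_pos.2 ⟨t, ht⟩
        have := tstage_ot P t i e
        exact (fμ_oTab_lt _ _ _ _ _ _ h).trans_le (M5_le (by omega))
      · obtain rfl := eq_of_fW_eq h
        exact fμ_zero_lt (tstage_pos _)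
  | rowI P e t r k c' =>
    revert h
    refine Fin.cases ?_ (Fin.cases ?_ (fun j => j.elim0)) a
    · intro h
      obtain rfl := eq_of_gW_eq h
      exact M5_lt (Or.inl (by rw [tstage_ct]; omega))
    · intro h
      have := tstage_ct P e
      exact (fμ_oTab_lt _ _ _ _ _ _ h).trans_le (M5_le (by omega))
  | blk χ k κ => exact fμ_lt_of_bargs χ k κ a h

/-- **Every wire of every gate comes from a gate of smaller measure.** -/
theorem fμ_lt_of_fargs {l l' : FΛ m} {a : Fin (ffn m l).1} (h : fargs l a = Sum.inr l') :
    fμ l' < fμ l := by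
  cases l with
  | inl l =>
    change (SymA.rargs l a).map id Sum.inl = Sum.inr l' at h
    cases hq : SymA.rargs l a with
    | inl q => rw [hq] at h; exact absurd h Sum.inl_ne_inr
    | inr l'' =>
      rw [hq] at h
      cases h
      have := SymA.rlayer_lt_of_rargs hq
      exact M5_lt (by omega)
  | inr f => exact fμ_lt_of_gargs f a h

/-- **Acyclicity of the F-side DAG** (first clause of `SymF.AutProps`; registered sub-goal of this
file): the child relation of the wiring is well founded. -/
theorem fargs_acyclic (m : ℕ) : WellFounded fun l' l : FΛ m => ∃ a, fargs l a = Sum.inr l' :=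
  Subrelation.wf (fun ⟨_, h⟩ => fμ_lt_of_fargs h) (InvImage.wf fμ wellFounded_lt)

end SymF

end Summit.PneNP.PneNP.Theorems.HamCompilesKC
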